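import Literature.NumberTheory.EllipticCurves.TakahashiDegreeFormula
import Literature.NumberTheory.EllipticCurves.BrandtModuleJLSelfPairing
import Literature.NumberTheory.DiophantineGeometry.MinimalDiscriminantProofs
import Literature.NumberTheory.DiophantineGeometry.MinimalDiscriminantFiniteProofs
import Mathlib.RingTheory.PrincipalIdealDomain
import Mathlib.RingTheory.Int.Basic
import Mathlib.LinearAlgebra.Dual.Defs
import Mathlib.LinearAlgebra.Isomorphisms
import Mathlib.LinearAlgebra.Quotient.Card
import Mathlib.Data.ZMod.QuotientRing
import Mathlib.LinearAlgebra.Dimension.FreeAndStrongRankCondition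
import Mathlib.LinearAlgebra.FreeModule.PID
import HarnessLib

/-!
# Takahashi 2001, §2: the algebra of `δ · i_r = h_r · j_r` (towards `takahashi2001_thm_2_3`)

Topic `Literature/NumberTheory/EllipticCurves`, sibling of `TakahashiDegreeFormula.lean` (the NAMED
FACT `takahashi2001_thm_2_3`, Takahashi 2001 Thm. 2.3 for `D = 1`). This file PROVES the part of
S. Takahashi, *Degrees of parametrizations of elliptic curves by Shimura curves*, J. Number Theory
**90** (2001) 74–88 [Takahashi2001], §2 pp. 78–80, that is algebra, in the generality in which it
is printed, and isolates what is not: the whole printed proof of Lemma 2.2 and Theorem 2.3 is a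
computation with two `ℤ`-bilinear pairings, and goes through verbatim for abstract data.

## The abstract setting (Takahashi §1–2, pp. 76–79, read: `lit read doi:10.1006/jnth.2000.2614`)

For an optimal quotient `π : J → E` (`J = J₀^D(M)`, here any abelian variety data) and a prime `r`:
* `X_J = X_r(J)`, `X_E = X_r(E)`: character groups of the toric parts of the Néron fibres at `r`
  (abelian groups), with Grothendieck's monodromy pairings `u_J`, `u_E` (`ℤ`-bilinear);
* `π^* : X_E → X_J` (`pb`) and `π_* : X_J → X_E` (`pf`), ADJOINT: `u_J(π^* x, y) = u_E(x, π_* y)`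
  (p. 78, "This follows from the description of monodromy pairings in [7]"), with
  `π_* ∘ π^* = δ` (p. 77: "`π_* ∘ π^*` is multiplication by `δ`") and `π_*` SURJECTIVE (p. 78:
  "Because … `π` is an optimal quotient, `π^∨` is injective. One deduces from this the
  surjectivity of `π_*`");
* `x_r` a generator of `X_E ≅ ℤ` with `c_r = u_E(x_r, x_r)` (p. 79, from Prop. 1.1:
  `c_r = #Φ_r(E)`), and `g = g_r` with `π^*(x_r) = j · g` (p. 79: "Choose a generator `x_r` … such
  that `π^*(x_r) = j_r · g_r`"; by Lemma 2.1 `|j| = j_r = #coker(Φ_r(J) → Φ_r(E))` when `g_r`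
  generates the saturated line `L_r(J)`), `h_r = u_J(g_r, g_r)`.

## What is proved (namespace `Literature.NumberTheory.EllipticCurves.Takahashi2001`)

* `mul_pairing_eq` — the displayed computation of Lemma 2.2: `π_* y = m x_r ⇒ j · u_J(g, y) = m · c_r`.
* `delta_mul_pairing_eq` — the displayed computation of Thm. 2.3: `δ · c_r = j² · h_r`.
* `exists_generator_range_pairing` — **Lemma 2.2 with `j_r = c_r / i_r`**: the ideal
  `I_r = {u_J(g, y) : y ∈ X_J}` (here literally `LinearMap.range (u_J g)`) is generated by a
  positive integer `i` with `i · |j| = c_r` (so `i = i_r = #image(Φ_r(J) → Φ_r(E))` once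
  `|j| = j_r`, by `i_r j_r = c_r`).
* `exists_index_formula` — **Theorem 2.3**: `i ∣ h_r` and `δ · i = h_r · |j|`.
* `exists_nat_index_formula` — the same in `ℕ`, in the exact shape of the conclusion of the named
  fact `takahashi2001_thm_2_3` (`∃ i j, 0 < i ∧ i * j = c ∧ i ∣ h ∧ δ * i = h * j`).
* Prop. 1.1 language (`Φ := Hom(X, ℤ)/α(X)`, `α(x) = u(x, ·)`, taken as the definition of the
  component groups): `card_componentGroup_eq_natAbs_pairing` — **`c_r = #Φ_r(E) = u_E(x_r, x_r)`**
  (p. 79); `range_le_comap_dualMap` / `range_le_range_dualMap` / `nonempty_coker_equiv` — the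
  commutative diagram of the proof of Lemma 2.1 and "the cokernels of `Hom(π^*, ℤ)` and the
  right-hand `π_*` may be identified"; `card_dual_quotient_range_dualMap` and
  `card_coker_componentGroup_map` — **Lemma 2.1**, `j_r = #coker(Φ_r(J) → Φ_r(E)) = |j|` for
  `π^* x_r = j g_r`, `g_r` unimodular; `card_range_componentGroup_map_mul` —
  **`#image · j_r = c_r`**, identifying `#image(Φ_r(J) → Φ_r(E))` with the generator `i_r` of
  `{u_J(g_r, y)}` (Lemma 2.2 as printed). These use the second adjointness
  `u_J(y, π^* x) = u_E(π_* y, x)` (automatic for the symmetric monodromy pairings).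
* `exists_dual_apply_eq_one`, `exists_dual_apply_eq_one_of_eigenLattice_eq` — a generator of a
  saturated line in `ℤ^ι` (e.g. of a Brandt eigen-line, `Brandt.mem_eigenLattice_of_smul_mem`) is
  unimodular: the hypothesis on `g_r` in Lemma 2.1.
* `exists_eq_span_of_finrank_eq_one`, `exists_eq_span_of_forall_dependent` — a sublattice of
  `ℤ^ι` of rank one (resp. nonzero with pairwise dependent elements) is a line `ℤ g`, `g ≠ 0`:
  the shape in which "`L_r(J)` is a free `ℤ`-module of rank one" (p. 78, multiplicity one)
  produces the generator `g_r` required below.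
* `exists_ij_of_brandtData` / `exists_ij_of_brandtData'` — Theorem 2.3 in Brandt coordinates
  for one curve and one setup (explicit generator `g`, resp. rank-one eigen-lattice containing
  `π^* 1` with `X` saturated), the pointwise engines of the two glue theorems.
* `takahashi2001_thm_2_3_of_brandtDictionary` (and the rank form
  `takahashi2001_thm_2_3_of_brandtDictionary'`; root namespace of the topic) — **the named fact
  from the geometric dictionary**: if, for the optimal curve and every Brandt setup `S` of type
  `(M, r)`, the character-group data of §2 are given inside the Brandt module `ℤ^{Cls O}` with
  Gross's pairing `Σ_i w_i x_i y_i` (the identification of p. 84: `X_r(J₀(Mr)) ≅ ℤ[Cls O]⁰`,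
  Hecke- and pairing-compatible), with `u_E(x_r, x_r) = ord_r Δ_min`, `π_* π^* = P.modularDegree`
  and `g_r` generating the `a(E)`-eigen-line, then `takahashi2001_thm_2_3` holds — by
  `exists_nat_index_formula`, `xi_lFunction_eq_sum` (`h_r = Σ_i w_i g_i² = S.xi`) and
  `r ∣ N_E ∣ Δ_min` (`c_r > 0`). Its hypothesis is the precise statement of what is missing.

Only the listed hypotheses are used: no freeness, symmetry or definiteness beyond `0 < c_r`, and no
sign condition on `δ` (the paper has `δ, h_r > 0`).

## What is NOT here (the geometric dictionary the named fact still needs; none of it is in Mathlib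
or the tree, searched `monodromy|Neron|componentGroup|characterGroup|J0`)

(M1) Néron models of `J₀(N)` and `E` at `r ∥ N`, character groups, Grothendieck's pairing and the
adjointness [SGA7 IX §§10–11; Prop. 1.1 = Thm. 11.5]; (M2) the optimal quotient with
`π ∘ π^∨ = δ`, surjectivity of `π_*`, and `δ = P.modularDegree` for a datum `P` of minimal degree
(`ModularParametrizationData.deg_spec` is analytic); (M3) `u_E(x_r, x_r) = ord_r Δ_min(E)` (Tate
curve); (M4) Deligne–Rapoport / Ribet 1990 §3 (Buzzard Thm. 4.7): `X_r(J₀(Mr)) ≅ ℤ[Cls O]⁰`,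
Hecke- and pairing-compatible, so `h_r = S.xi (a(E))` for every `Brandt.XiSetup S` of type
`(M, r)`; (M5) multiplicity one (`L_r(J)` has rank one). (M1)–(M5) give the hypothesis of
`takahashi2001_thm_2_3_of_brandtDictionary`, whence the named fact. Lemma 2.1 (proved above in
the abstract) is not needed for that deduction.

## References

* [Takahashi2001] S. Takahashi, J. Number Theory 90 (2001) 74–88, doi:10.1006/jnth.2000.2614,
  §2: Lemma 2.1, Lemma 2.2, Theorem 2.3 (pp. 78–80). READ (pp. 74–85).
* [RibetTakahashi1997] K. Ribet, S. Takahashi, PNAS 94 (1997), Prop. 2 and proof of Thm. 2 (the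
  source of Lemma 2.1 and of the formula, as Takahashi notes on p. 79).
-/

namespace Literature.NumberTheory.EllipticCurves

namespace Takahashi2001

section Abstract

variable {XJ XE : Type*} [AddCommGroup XJ] [AddCommGroup XE]
  (uJ : XJ →ₗ[ℤ] XJ →ₗ[ℤ] ℤ) (uE : XE →ₗ[ℤ] XE →ₗ[ℤ] ℤ) (pb : XE →ₗ[ℤ] XJ) (pf : XJ →ₗ[ℤ] XE)

/-- **The computation in the proof of Lemma 2.2** (Takahashi 2001, p. 79): if `π^* x_r = j · g`
and `π_* y = m · x_r`, then `j · u_J(g, y) = u_J(π^* x_r, y) = u_E(x_r, π_* y) = m · u_E(x_r, x_r)`,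
by adjointness of `π^*` and `π_*` for the monodromy pairings. [cite: Takahashi2001, Lemma 2.2 (proof)] -/
theorem mul_pairing_eq (hadj : ∀ (x : XE) (y : XJ), uJ (pb x) y = uE x (pf y)) {xr : XE} {g : XJ}
    {j : ℤ} (hg : pb xr = j • g) {y : XJ} {m : ℤ} (hy : pf y = m • xr) :
    j * uJ g y = m * uE xr xr := by
  have h1 : uJ (pb xr) y = uE xr (pf y) := hadj xr y
  rwa [hg, hy, map_smul, LinearMap.smul_apply, smul_eq_mul, map_smul, smul_eq_mul] at h1

/-- **The computation in the proof of Theorem 2.3** (Takahashi 2001, p. 80):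
`δ · c_r = δ · u_E(x_r, x_r) = u_E(x_r, π_* π^* x_r) = u_J(π^* x_r, π^* x_r) = j² · h_r`, where
`π_* ∘ π^* = δ`, `π^* x_r = j · g` and `h_r = u_J(g, g)`. [cite: Takahashi2001, Thm. 2.3 (proof)] -/
theorem delta_mul_pairing_eq (hadj : ∀ (x : XE) (y : XJ), uJ (pb x) y = uE x (pf y)) {δ : ℤ}
    (hδ : ∀ x : XE, pf (pb x) = δ • x) {xr : XE} {g : XJ} {j : ℤ} (hg : pb xr = j • g) :
    δ * uE xr xr = j ^ 2 * uJ g g := by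
  have h1 : uJ (pb xr) (pb xr) = uE xr (pf (pb xr)) := hadj xr (pb xr)
  rw [hδ] at h1
  simp only [hg, map_smul, LinearMap.smul_apply, smul_eq_mul] at h1
  linear_combination -h1

/-- **Lemma 2.2 together with `i_r · j_r = c_r`** (Takahashi 2001, p. 79), abstract form. Assume
adjointness, `π_*` surjective (optimality), `X_E = ℤ · x_r`, `c_r := u_E(x_r, x_r) > 0` and
`π^* x_r = j · g`. Then the ideal `I_r = {u_J(g, y) : y ∈ X_J}` of `ℤ` (the range of the linear
form `u_J(g, ·)`) is generated by a positive integer `i` with `i · |j| = c_r`. Printed proof: every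
`j · u_J(g, y)` is a multiple `m · c_r`, and surjectivity gives `y` with `j · u_J(g, y) = c_r`; so
`(j) · I_r = (c_r)`. (In the paper `i = i_r := #image(Φ_r(J) → Φ_r(E))` and `|j| = j_r`, via
Lemma 2.1 and `j_r = c_r / i_r`; here `i` is produced directly as the generator.)
[cite: Takahashi2001, Lemma 2.2] -/
theorem exists_generator_range_pairing (hadj : ∀ (x : XE) (y : XJ), uJ (pb x) y = uE x (pf y))
    (hsurj : Function.Surjective pf) {xr : XE} (hgen : ∀ x : XE, ∃ m : ℤ, m • xr = x)
    (hc : 0 < uE xr xr) {g : XJ} {j : ℤ} (hg : pb xr = j • g) :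
    ∃ i : ℕ, 0 < i ∧ LinearMap.range (uJ g) = Ideal.span {(i : ℤ)} ∧ (i : ℤ) * |j| = uE xr xr := by
  set I : Ideal ℤ := LinearMap.range (uJ g) with hI
  haveI : I.IsPrincipal := IsPrincipalIdealRing.principal I
  set a : ℤ := Submodule.IsPrincipal.generator I with ha
  have haI : I = Ideal.span {a} := (Submodule.IsPrincipal.span_singleton_generator I).symm
  -- `a ∣ u_J(g, y)` for every `y`
  have hdvd : ∀ y : XJ, a ∣ uJ g y := fun y => by
    have hy : uJ g y ∈ I := LinearMap.mem_range_self (uJ g) y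
    rw [haI] at hy
    exact Ideal.mem_span_singleton.mp hy
  -- `a = u_J(g, y₁)` for some `y₁`
  obtain ⟨y₁, hy₁⟩ : ∃ y₁ : XJ, uJ g y₁ = a := by
    have ha' : a ∈ I := Submodule.IsPrincipal.generator_mem I
    exact LinearMap.mem_range.mp ha'
  -- surjectivity of `π_*`: `π_* y₀ = x_r`, so `j · u_J(g, y₀) = c_r`
  obtain ⟨y₀, hy₀⟩ := hsurj xr
  have hA : j * uJ g y₀ = uE xr xr := by
    have h := mul_pairing_eq uJ uE pb pf hadj hg (y := y₀) (m := 1) (by rw [hy₀, one_smul])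
    rwa [one_mul] at h
  -- `c_r ∣ j · a` (write `π_* y₁ = m₁ x_r`)
  obtain ⟨m₁, hm₁⟩ := hgen (pf y₁)
  have hB : uE xr xr ∣ j * a :=
    ⟨m₁, by rw [← hy₁, mul_pairing_eq uJ uE pb pf hadj hg hm₁.symm, mul_comm]⟩
  -- `j · a ∣ c_r`
  have hC : j * a ∣ uE xr xr := by
    rw [← hA]
    exact mul_dvd_mul_left j (hdvd y₀)
  -- hence `|j| · |a| = c_r`
  have habs : (j * a).natAbs = (uE xr xr).natAbs :=
    Nat.dvd_antisymm (Int.natAbs_dvd_natAbs.mpr hC) (Int.natAbs_dvd_natAbs.mpr hB)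
  have hcabs : ((uE xr xr).natAbs : ℤ) = uE xr xr := Int.natAbs_of_nonneg hc.le
  refine ⟨a.natAbs, ?_, ?_, ?_⟩
  · -- `i > 0` since `c_r > 0`
    refine Nat.pos_of_ne_zero fun h0 => ?_
    have : (uE xr xr).natAbs = 0 := by rw [← habs, Int.natAbs_mul, h0, mul_zero]
    omega
  · rw [haI, Int.span_natAbs]
  · rw [← hcabs, ← habs, Int.natAbs_mul, Nat.cast_mul, mul_comm, Int.natCast_natAbs j]

/-- **Theorem 2.3** (Takahashi 2001, pp. 79–80), abstract form: with the data and hypotheses of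
`exists_generator_range_pairing` and `π_* ∘ π^* = δ`, the positive generator `i` of
`I_r = {u_J(g, y)}` satisfies `i · |j| = c_r`, **`i ∣ h_r`** and **`δ · i = h_r · |j|`**, where
`h_r = u_J(g, g)`; i.e. `i_r ∣ h_r` and `δ = (h_r / i_r) · j_r`. Printed proof: `i_r ∣ h_r` as
`h_r ∈ I_r`; `δ c_r = j_r² h_r` (`delta_mul_pairing_eq`) and `c_r = i_r j_r`. No sign hypothesis on
`δ` is needed. [cite: Takahashi2001, Thm. 2.3] -/
theorem exists_index_formula (hadj : ∀ (x : XE) (y : XJ), uJ (pb x) y = uE x (pf y)) {δ : ℤ}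
    (hδ : ∀ x : XE, pf (pb x) = δ • x) (hsurj : Function.Surjective pf) {xr : XE}
    (hgen : ∀ x : XE, ∃ m : ℤ, m • xr = x) (hc : 0 < uE xr xr) {g : XJ} {j : ℤ}
    (hg : pb xr = j • g) :
    ∃ i : ℕ, 0 < i ∧ LinearMap.range (uJ g) = Ideal.span {(i : ℤ)} ∧ (i : ℤ) * |j| = uE xr xr ∧
      (i : ℤ) ∣ uJ g g ∧ δ * i = uJ g g * |j| := by
  obtain ⟨i, hi, hI, hij⟩ := exists_generator_range_pairing uJ uE pb pf hadj hsurj hgen hc hg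
  refine ⟨i, hi, hI, hij, ?_, ?_⟩
  · -- `h_r = u_J(g, g) ∈ I_r = (i)`
    have h : uJ g g ∈ LinearMap.range (uJ g) := LinearMap.mem_range_self (uJ g) g
    rw [hI] at h
    exact Ideal.mem_span_singleton.mp h
  · -- `δ c_r = j² h_r`, `c_r = i |j|`, cancel `|j| ≠ 0`
    have hδc := delta_mul_pairing_eq uJ uE pb pf hadj hδ hg
    have hj : |j| ≠ 0 := by
      intro hj
      rw [hj, mul_zero] at hij
      exact hc.ne' hij.symm
    have hsq : j ^ 2 = |j| * |j| := by rw [abs_mul_abs_self, sq]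
    rw [← hij, hsq] at hδc
    -- hδc : δ * (i * |j|) = |j| * |j| * uJ g g
    have : (δ * i - uJ g g * |j|) * |j| = 0 := by linear_combination hδc
    rcases mul_eq_zero.mp this with h | h
    · linear_combination h
    · exact absurd h hj

/-- **Theorem 2.3 in `ℕ`**, in the shape of the conclusion of the named fact
`takahashi2001_thm_2_3`: if `π_* ∘ π^* = δ` (`δ : ℕ`), `u_E(x_r, x_r) = c > 0` and
`u_J(g, g) = h` (`c h : ℕ`), then there are `i j : ℕ` with `0 < i`, `i * j = c`, `i ∣ h` and
`δ * i = h * j` (namely `i = i_r`, `j = |j| = j_r`). This is exactly what remains of the named fact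
once the geometric dictionary (module docstring, (M1)–(M5)) supplies the data.
[cite: Takahashi2001, Thm. 2.3] -/
theorem exists_nat_index_formula (hadj : ∀ (x : XE) (y : XJ), uJ (pb x) y = uE x (pf y)) {δ : ℕ}
    (hδ : ∀ x : XE, pf (pb x) = (δ : ℤ) • x) (hsurj : Function.Surjective pf) {xr : XE}
    (hgen : ∀ x : XE, ∃ m : ℤ, m • xr = x) {c : ℕ} (hc : uE xr xr = c) (hc0 : 0 < c) {g : XJ}
    {j : ℤ} (hg : pb xr = j • g) {h : ℕ} (hh : uJ g g = h) :
    ∃ i j : ℕ, 0 < i ∧ i * j = c ∧ i ∣ h ∧ δ * i = h * j := by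
  have hc' : 0 < uE xr xr := by rw [hc]; exact_mod_cast hc0
  obtain ⟨i, hi, -, hij, hih, hδi⟩ := exists_index_formula uJ uE pb pf hadj hδ hsurj hgen hc' hg
  refine ⟨i, j.natAbs, hi, ?_, ?_, ?_⟩
  · have h1 : ((i * j.natAbs : ℕ) : ℤ) = (c : ℤ) := by
      rw [Nat.cast_mul, Int.natCast_natAbs, hij, hc]
    exact_mod_cast h1
  · rw [hh] at hih
    exact_mod_cast hih
  · have h1 : ((δ * i : ℕ) : ℤ) = ((h * j.natAbs : ℕ) : ℤ) := by
      rw [Nat.cast_mul, Nat.cast_mul, Int.natCast_natAbs, hδi, hh]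
    exact_mod_cast h1

end Abstract

/-! ### Component groups through Prop. 1.1: `c_r = #Φ_r(E)`, Lemma 2.1, and `i_r = #image` -/

section ComponentGroups

open Module

variable {XJ XE : Type*} [AddCommGroup XJ] [AddCommGroup XE]
  (uJ : XJ →ₗ[ℤ] XJ →ₗ[ℤ] ℤ) (uE : XE →ₗ[ℤ] XE →ₗ[ℤ] ℤ) (pb : XE →ₗ[ℤ] XJ) (pf : XJ →ₗ[ℤ] XE)

/-- **Counting a quotient of `Hom(X_r(E), ℤ) ≅ ℤ`.** If `X_E = ℤ x_r` is free of rank one on `x_r`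
(`x_r` generates and is torsion-free), then evaluation at `x_r` identifies `Hom(X_E, ℤ)` with `ℤ`,
and a subgroup `S ⊆ Hom(X_E, ℤ)` whose values at `x_r` are exactly the multiples of `k` has
`#(Hom(X_E, ℤ)/S) = |k|` (`= 0`, i.e. infinite, for `k = 0`). The common count behind
`c_r = #Φ_r(E) = u_E(x_r, x_r)` and Lemma 2.1. [folklore] -/
theorem card_dual_quotient_eq_natAbs {xr : XE} (hgen : ∀ x : XE, ∃ m : ℤ, m • xr = x)
    (htf : ∀ m : ℤ, m • xr = 0 → m = 0) (S : Submodule ℤ (Dual ℤ XE)) {k : ℤ}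
    (hS : ∀ n : ℤ, (∃ φ ∈ S, φ xr = n) ↔ k ∣ n) :
    Nat.card (Dual ℤ XE ⧸ S) = k.natAbs := by
  -- `X_E ≅ ℤ`, `m ↦ m x_r`
  let e : ℤ ≃ₗ[ℤ] XE := LinearEquiv.ofBijective (LinearMap.toSpanSingleton ℤ XE xr)
    ⟨(injective_iff_map_eq_zero _).mpr fun m hm => htf m (by
        rwa [LinearMap.toSpanSingleton_apply] at hm),
      fun x => by
        obtain ⟨m, rfl⟩ := hgen x
        exact ⟨m, LinearMap.toSpanSingleton_apply _ _ _ _⟩⟩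
  have he1 : e 1 = xr := by
    change LinearMap.toSpanSingleton ℤ XE xr 1 = xr
    rw [LinearMap.toSpanSingleton_apply, one_smul]
  -- evaluation at `x_r`: `Hom(X_E, ℤ) ≅ ℤ`
  let ev : Dual ℤ XE →ₗ[ℤ] ℤ :=
    { toFun := fun φ => φ xr
      map_add' := fun φ ψ => LinearMap.add_apply φ ψ xr
      map_smul' := fun m φ => LinearMap.smul_apply m φ xr }
  have hev : ∀ φ : Dual ℤ XE, ev φ = φ xr := fun φ => rfl
  have hinj : Function.Injective ev := by
    refine (injective_iff_map_eq_zero _).mpr fun φ hφ => ?_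
    rw [hev] at hφ
    ext x
    obtain ⟨m, rfl⟩ := hgen x
    rw [map_zsmul, hφ, smul_zero, LinearMap.zero_apply]
  have hsurj : Function.Surjective ev := fun n =>
    ⟨n • (e.symm : XE →ₗ[ℤ] ℤ), by
      rw [hev, LinearMap.smul_apply, LinearEquiv.coe_coe, ← he1, e.symm_apply_apply, smul_eq_mul,
        mul_one]⟩
  let evE : Dual ℤ XE ≃ₗ[ℤ] ℤ := LinearEquiv.ofBijective ev ⟨hinj, hsurj⟩
  have hevE : ∀ φ : Dual ℤ XE, evE φ = φ xr := fun φ => rfl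
  -- `S ↦ (k)`
  have hmap : S.map (evE : Dual ℤ XE →ₗ[ℤ] ℤ) = Ideal.span {k} := by
    ext n
    rw [Submodule.mem_map, Ideal.mem_span_singleton, ← hS n]
    constructor
    · rintro ⟨φ, hφ, rfl⟩
      exact ⟨φ, hφ, (hevE φ).symm⟩
    · rintro ⟨φ, hφ, hn⟩
      exact ⟨φ, hφ, (hevE φ).trans hn⟩
  rw [Nat.card_congr (Submodule.Quotient.equiv S (Ideal.span {k}) evE hmap).toEquiv,
    Nat.card_congr (Int.quotientSpanEquivZMod k).toEquiv, Nat.card_zmod]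

/-- **`c_r = #Φ_r(E) = u_E(x_r, x_r)`** (Takahashi 2001, p. 79: "By Proposition 1.1, we have
`c_r = u_E(x_r, x_r)`"): with `Φ_r(E) := Hom(X_r(E), ℤ)/α(X_r(E))`, `α(x)(y) = u_E(x, y)`
(Grothendieck's exact sequence, Prop. 1.1 = SGA7 IX Thm. 11.5, taken as the definition of the
component group) and `X_r(E) = ℤ x_r`, the order of `Φ_r(E)` is `|u_E(x_r, x_r)|`.
[cite: Takahashi2001, Prop. 1.1 and p. 79] -/
theorem card_componentGroup_eq_natAbs_pairing {xr : XE} (hgen : ∀ x : XE, ∃ m : ℤ, m • xr = x)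
    (htf : ∀ m : ℤ, m • xr = 0 → m = 0) :
    Nat.card (Dual ℤ XE ⧸ LinearMap.range uE) = (uE xr xr).natAbs := by
  refine card_dual_quotient_eq_natAbs hgen htf _ fun n => ⟨?_, ?_⟩
  · rintro ⟨_, ⟨x, rfl⟩, rfl⟩
    obtain ⟨m, rfl⟩ := hgen x
    exact ⟨m, by rw [map_zsmul, LinearMap.smul_apply, smul_eq_mul, mul_comm]⟩
  · rintro ⟨t, rfl⟩
    exact ⟨uE (t • xr), LinearMap.mem_range_self _ _, by
      rw [map_zsmul, LinearMap.smul_apply, smul_eq_mul, mul_comm]⟩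

/-- The second adjointness `u_J(y, π^* x) = u_E(π_* y, x)` (equivalent to the first for the
symmetric monodromy pairings) makes the square of Prop. 1.1 sequences commute:
`Hom(π^*, ℤ) ∘ α_J = α_E ∘ π_*`, i.e. `α_J(X_J)` is mapped into `α_E(X_E)`, so that `π_*` induces
a map `Φ_r(J) → Φ_r(E)` on the cokernels (the right-hand vertical map of the diagram in the proof of
Lemma 2.1). [cite: Takahashi2001, Lemma 2.1 (proof)] -/
theorem range_le_comap_dualMap (hadj₂ : ∀ (y : XJ) (x : XE), uJ y (pb x) = uE (pf y) x) :
    LinearMap.range uJ ≤ (LinearMap.range uE).comap pb.dualMap := by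
  rintro _ ⟨y, rfl⟩
  refine ⟨pf y, ?_⟩
  ext x
  rw [LinearMap.dualMap_apply, hadj₂]

/-- If moreover `π_*` is surjective (optimality), `α_E(X_E) ⊆ Hom(π^*, ℤ)(Hom(X_J, ℤ))`: "Because
the left-hand `π_*` in the above diagram is surjective, the cokernels of `Hom(π^*, ℤ)` and the
right-hand `π_*` may be identified" (Takahashi 2001, proof of Lemma 2.1).
[cite: Takahashi2001, Lemma 2.1 (proof)] -/
theorem range_le_range_dualMap (hadj₂ : ∀ (y : XJ) (x : XE), uJ y (pb x) = uE (pf y) x)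
    (hsurj : Function.Surjective pf) :
    LinearMap.range uE ≤ LinearMap.range pb.dualMap := by
  rintro _ ⟨x, rfl⟩
  obtain ⟨y, rfl⟩ := hsurj x
  refine ⟨uJ y, ?_⟩
  ext x'
  rw [LinearMap.dualMap_apply, hadj₂]

/-- **The cokernel of `π_* : Φ_r(J) → Φ_r(E)` is `Hom(X_r(E), ℤ) / Hom(π^*, ℤ)(Hom(X_r(J), ℤ))`**
(Takahashi 2001, proof of Lemma 2.1), for `Φ := Hom(X, ℤ)/α(X)` as in Prop. 1.1 and the map induced
by `Hom(π^*, ℤ)` (`Submodule.mapQ`), under the second adjointness and surjectivity of `π_*`: the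
range of the induced map is the image of `range Hom(π^*, ℤ) ⊇ α_E(X_E)`, and
`(A/q)/((T ⊔ q)/q) ≅ A/T` (third isomorphism theorem). [cite: Takahashi2001, Lemma 2.1 (proof)] -/
theorem nonempty_coker_equiv (hadj₂ : ∀ (y : XJ) (x : XE), uJ y (pb x) = uE (pf y) x)
    (hsurj : Function.Surjective pf)
    (h : LinearMap.range uJ ≤ (LinearMap.range uE).comap pb.dualMap) :
    Nonempty (((Dual ℤ XE ⧸ LinearMap.range uE) ⧸
        LinearMap.range ((LinearMap.range uJ).mapQ (LinearMap.range uE) pb.dualMap h)) ≃ₗ[ℤ]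
      (Dual ℤ XE ⧸ LinearMap.range pb.dualMap)) := by
  set q : Submodule ℤ (Dual ℤ XE) := LinearMap.range uE
  set T : Submodule ℤ (Dual ℤ XE) := LinearMap.range pb.dualMap
  have hqT : q ≤ T := range_le_range_dualMap uJ uE pb pf hadj₂ hsurj
  have hrange : LinearMap.range ((LinearMap.range uJ).mapQ q pb.dualMap h) = T.map q.mkQ :=
    Submodule.range_mapQ _ _ pb.dualMap h
  have hT : T = q ⊔ T := (sup_eq_right.mpr hqT).symm
  refine ⟨(Submodule.quotEquivOfEq _ _ (by rw [hrange, Submodule.map_sup, Submodule.mkQ_map_self,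
      bot_sup_eq] : LinearMap.range ((LinearMap.range uJ).mapQ q pb.dualMap h) =
        (q ⊔ T).map q.mkQ)).trans
    ((Submodule.quotientQuotientEquivQuotient q (q ⊔ T) le_sup_left).trans
      (Submodule.quotEquivOfEq _ _ hT.symm))⟩

/-- **Lemma 2.1** (Takahashi 2001, pp. 78–79; Ribet–Takahashi 1997 Prop. 2), abstract form:
`#(Hom(X_r(E), ℤ) / Hom(π^*, ℤ)(Hom(X_r(J), ℤ))) = |j|` where `π^* x_r = j · g` and `g` is
unimodular in `X_J` (some functional takes the value `1` on `g`; this holds for a generator of the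
saturated line `L_r(J)` in the free `ℤ`-module `X_r(J)`), `X_r(E) = ℤ x_r`. With
`nonempty_coker_equiv` this is `j_r := #coker(Φ_r(J) → Φ_r(E)) = (L_r(J) : π^* X_r(E)) = |j|`.
[cite: Takahashi2001, Lemma 2.1] -/
theorem card_dual_quotient_range_dualMap {xr : XE} (hgen : ∀ x : XE, ∃ m : ℤ, m • xr = x)
    (htf : ∀ m : ℤ, m • xr = 0 → m = 0) {g : XJ} (hunimod : ∃ φ : Dual ℤ XJ, φ g = 1) {j : ℤ}
    (hg : pb xr = j • g) :
    Nat.card (Dual ℤ XE ⧸ LinearMap.range pb.dualMap) = j.natAbs := by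
  obtain ⟨φ₀, hφ₀⟩ := hunimod
  refine card_dual_quotient_eq_natAbs hgen htf _ fun n => ⟨?_, ?_⟩
  · rintro ⟨_, ⟨ψ, rfl⟩, rfl⟩
    exact ⟨ψ g, by rw [LinearMap.dualMap_apply, hg, map_zsmul, smul_eq_mul]⟩
  · rintro ⟨t, rfl⟩
    refine ⟨pb.dualMap (t • φ₀), LinearMap.mem_range_self _ _, ?_⟩
    rw [LinearMap.dualMap_apply, hg, map_zsmul, LinearMap.smul_apply, hφ₀, smul_eq_mul, smul_eq_mul,
      mul_one]

/-- **Lemma 2.1 for the component groups themselves**: with `Φ_r(J) := Hom(X_r(J), ℤ)/α_J(X_r(J))`,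
`Φ_r(E) := Hom(X_r(E), ℤ)/α_E(X_r(E))` (Prop. 1.1) and `π_* : Φ_r(J) → Φ_r(E)` induced by
`Hom(π^*, ℤ)`, `j_r := #coker(π_*) = |j|` (`π^* x_r = j · g_r`, `g_r` unimodular), under the second
adjointness and surjectivity of `π_*` on character groups. [cite: Takahashi2001, Lemma 2.1] -/
theorem card_coker_componentGroup_map (hadj₂ : ∀ (y : XJ) (x : XE), uJ y (pb x) = uE (pf y) x)
    (hsurj : Function.Surjective pf)
    (h : LinearMap.range uJ ≤ (LinearMap.range uE).comap pb.dualMap) {xr : XE}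
    (hgen : ∀ x : XE, ∃ m : ℤ, m • xr = x) (htf : ∀ m : ℤ, m • xr = 0 → m = 0) {g : XJ}
    (hunimod : ∃ φ : Dual ℤ XJ, φ g = 1) {j : ℤ} (hg : pb xr = j • g) :
    Nat.card ((Dual ℤ XE ⧸ LinearMap.range uE) ⧸
        LinearMap.range ((LinearMap.range uJ).mapQ (LinearMap.range uE) pb.dualMap h)) =
      j.natAbs := by
  obtain ⟨e⟩ := nonempty_coker_equiv uJ uE pb pf hadj₂ hsurj h
  rw [Nat.card_congr e.toEquiv, card_dual_quotient_range_dualMap pb hgen htf hunimod hg]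

/-- **`i_r = #image(Φ_r(J) → Φ_r(E))` and `i_r · j_r = c_r`** (Takahashi 2001, p. 79: "Since
`j_r = c_r / i_r` …"): the image of the induced map has order `i` with `i · |j| = |u_E(x_r, x_r)|`
(Lagrange in the finite group `Φ_r(E)`; `card_componentGroup_eq_natAbs_pairing` and
`card_coker_componentGroup_map`). Together with `exists_generator_range_pairing` (`i' · |j| = c_r`
for the positive generator `i'` of `{u_J(g_r, y)}`) this identifies that generator with
`#image`, which is Lemma 2.2 as printed. [cite: Takahashi2001, Lemma 2.2] -/
theorem card_range_componentGroup_map_mul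
    (hadj₂ : ∀ (y : XJ) (x : XE), uJ y (pb x) = uE (pf y) x) (hsurj : Function.Surjective pf)
    (h : LinearMap.range uJ ≤ (LinearMap.range uE).comap pb.dualMap) {xr : XE}
    (hgen : ∀ x : XE, ∃ m : ℤ, m • xr = x) (htf : ∀ m : ℤ, m • xr = 0 → m = 0) {g : XJ}
    (hunimod : ∃ φ : Dual ℤ XJ, φ g = 1) {j : ℤ} (hg : pb xr = j • g) :
    Nat.card (LinearMap.range ((LinearMap.range uJ).mapQ (LinearMap.range uE) pb.dualMap h)) *
        j.natAbs = (uE xr xr).natAbs := by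
  rw [← card_componentGroup_eq_natAbs_pairing uE hgen htf,
    ← card_coker_componentGroup_map uJ uE pb pf hadj₂ hsurj h hgen htf hunimod hg]
  exact (Submodule.card_eq_card_quotient_mul_card _).symm

end ComponentGroups

/-! ### Generators of saturated lines are unimodular (the hypothesis of Lemma 2.1 for `g_r`) -/

section Unimodular

/-- **A generator of a saturated line in `ℤ^ι` is unimodular**: if `L = ℤ g ⊆ ℤ^ι` (`g ≠ 0`) is
saturated (`c v ∈ L`, `c ≠ 0 ⇒ v ∈ L`; e.g. `L = L_r(J)`, "`X_r(J)/L_r(J)` is torsion free by the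
definition of `L_r(J)`", Takahashi 2001 p. 79), then some `ℤ`-linear functional takes the value
`1` on `g` — the form in which Lemma 2.1 uses that `g_r` generates `L_r(J)`. Proof: the values
`{φ(g)}` form an ideal `(d)`, `d` divides every coordinate of `g`, so `g = d g'` with `g' ∈ L` by
saturation, `g' = m g`, `d m = 1`. No finiteness of `ι` is needed. [folklore] -/
theorem exists_dual_apply_eq_one {ι : Type*} {L : Submodule ℤ (ι → ℤ)}
    (hsat : ∀ (c : ℤ) (v : ι → ℤ), c ≠ 0 → c • v ∈ L → v ∈ L) {g : ι → ℤ} (hg0 : g ≠ 0)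
    (hL : L = ℤ ∙ g) : ∃ φ : Module.Dual ℤ (ι → ℤ), φ g = 1 := by
  let ev : Module.Dual ℤ (ι → ℤ) →ₗ[ℤ] ℤ :=
    { toFun := fun φ => φ g
      map_add' := fun φ ψ => LinearMap.add_apply φ ψ g
      map_smul' := fun m φ => LinearMap.smul_apply m φ g }
  have hev : ∀ φ : Module.Dual ℤ (ι → ℤ), ev φ = φ g := fun φ => rfl
  set I : Ideal ℤ := LinearMap.range ev with hIdef
  haveI : I.IsPrincipal := IsPrincipalIdealRing.principal I
  set d : ℤ := Submodule.IsPrincipal.generator I with hd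
  have hI : I = Ideal.span {d} := (Submodule.IsPrincipal.span_singleton_generator I).symm
  -- `d` divides every coordinate `g i = proj_i (g)`
  have hcoord : ∀ i : ι, d ∣ g i := fun i => by
    have hi : g i ∈ I := ⟨LinearMap.proj i, rfl⟩
    rw [hI] at hi
    exact Ideal.mem_span_singleton.mp hi
  choose g' hg' using hcoord
  have hdg' : d • (fun i => g' i) = g := funext fun i => by rw [Pi.smul_apply, smul_eq_mul, ← hg' i]
  have hd0 : d ≠ 0 := by
    rintro hd0
    apply hg0
    rw [← hdg', hd0, zero_smul]
  -- saturation: `g' ∈ L = ℤ g`, `g' = m g`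
  have hg'L : (fun i => g' i) ∈ L :=
    hsat d _ hd0 (by rw [hdg', hL]; exact Submodule.mem_span_singleton_self g)
  rw [hL] at hg'L
  obtain ⟨m, hm⟩ := Submodule.mem_span_singleton.mp hg'L
  -- `g = d m g`, so `d m = 1` (`g ≠ 0`)
  have hdm : d * m = 1 := by
    obtain ⟨i, hi⟩ : ∃ i, g i ≠ 0 := Function.ne_iff.mp hg0
    have h1 : m * g i = g' i := by
      have := congrFun hm i
      rwa [Pi.smul_apply, smul_eq_mul] at this
    have h2 : (d * m - 1) * g i = 0 := by
      have h3 := hg' i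
      rw [← h1] at h3
      linear_combination -h3
    rcases mul_eq_zero.mp h2 with h | h
    · linear_combination h
    · exact absurd h hi
  -- `d = φ(g)` for some `φ`; then `(m φ)(g) = m d = 1`
  obtain ⟨φ, hφ⟩ : ∃ φ : Module.Dual ℤ (ι → ℤ), φ g = d := by
    have hdI : d ∈ I := Submodule.IsPrincipal.generator_mem I
    obtain ⟨φ, hφ⟩ := LinearMap.mem_range.mp hdI
    exact ⟨φ, (hev φ).symm.trans hφ⟩
  exact ⟨m • φ, by rw [LinearMap.smul_apply, hφ, smul_eq_mul, mul_comm, hdm]⟩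

open Literature.NumberTheory.Automorphic in
/-- **The generator of the Brandt eigen-line is unimodular in `ℤ^{Cls O}`**: if the common
eigen-lattice of the matrices `T(p)` (`p ∤ N`) is the line `ℤ g`, `g ≠ 0` (the multiplicity-one
situation for `L_r(J) ⊆ X_r(J) ⊆ ℤ^{Cls O}`), then some functional on `ℤ^{Cls O}` (hence, by
restriction, on any sublattice containing `g`) takes the value `1` on `g`, because eigen-lattices
are saturated (`Brandt.mem_eigenLattice_of_smul_mem`). This supplies the hypothesis `hunimod` of
`card_dual_quotient_range_dualMap` (Lemma 2.1) in Brandt coordinates. [folklore] -/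
theorem exists_dual_apply_eq_one_of_eigenLattice_eq {ι : Type*} [Fintype ι] {N : ℕ}
    {T : ℕ → Matrix ι ι ℤ} {lam : ℕ → ℤ} {g : ι → ℤ} (hg0 : g ≠ 0)
    (hL : Brandt.eigenLattice N T lam = ℤ ∙ g) : ∃ φ : Module.Dual ℤ (ι → ℤ), φ g = 1 :=
  exists_dual_apply_eq_one (fun _ _ hc hv => Brandt.mem_eigenLattice_of_smul_mem hc hv) hg0 hL

end Unimodular

/-! ### Lines: rank one ⇒ `L = ℤ g` (the shape of the multiplicity-one input) -/

section Lines

/-- **A sublattice of `ℤ^ι` of rank one is a line `ℤ g`, `g ≠ 0`** (submodules of `ℤ^ι` are free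
of finite rank, `ℤ` being a PID). The form in which "`L_r(J)` is a free `ℤ`-module of rank one"
(Takahashi 2001, p. 78; multiplicity one) yields the generator `g_r`. [folklore] -/
theorem exists_eq_span_of_finrank_eq_one {ι : Type*} [Finite ι] {L : Submodule ℤ (ι → ℤ)}
    (h1 : Module.finrank ℤ L = 1) : ∃ g : ι → ℤ, g ≠ 0 ∧ L = ℤ ∙ g := by
  obtain ⟨v, hv0, hv⟩ := finrank_eq_one_iff'.mp h1
  refine ⟨(v : ι → ℤ), fun h => hv0 (Subtype.ext h), le_antisymm (fun x hx => ?_) ?_⟩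
  · obtain ⟨c, hc⟩ := hv ⟨x, hx⟩
    exact Submodule.mem_span_singleton.mpr ⟨c, congrArg Subtype.val hc⟩
  · rw [Submodule.span_singleton_le_iff_mem]
    exact v.2

/-- **Rank one from pairwise dependence**: a nonzero sublattice `L ⊆ ℤ^ι` any two of whose
elements are `ℤ`-linearly dependent is a line `ℤ g`, `g ≠ 0`. (For the eigen-lattice `L_r(J)` of
the Brandt matrices both hypotheses are the Jacquet–Langlands / strong-multiplicity-one input:
the rational eigenspace is one-dimensional and nonzero.) [folklore] -/
theorem exists_eq_span_of_forall_dependent {ι : Type*} [Finite ι] {L : Submodule ℤ (ι → ℤ)}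
    (hL : L ≠ ⊥)
    (hdep : ∀ v ∈ L, ∀ w ∈ L, ∃ a b : ℤ, (a ≠ 0 ∨ b ≠ 0) ∧ a • v = b • w) :
    ∃ g : ι → ℤ, g ≠ 0 ∧ L = ℤ ∙ g := by
  classical
  refine exists_eq_span_of_finrank_eq_one ?_
  let b := Module.Free.chooseBasis ℤ L
  haveI : Fintype (Module.Free.ChooseBasisIndex ℤ L) := Module.Free.ChooseBasisIndex.fintype ℤ L
  -- any two basis vectors coincide, by pairwise dependence
  have hsub : ∀ i j : Module.Free.ChooseBasisIndex ℤ L, i = j := by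
    intro i j
    by_contra hij
    obtain ⟨a, c, hac, h⟩ := hdep _ (b i).2 _ (b j).2
    have h' : a • b i = c • b j := Subtype.ext h
    have hrepr := congrArg b.repr h'
    rw [map_zsmul, map_zsmul, b.repr_self, b.repr_self] at hrepr
    have hi := Finsupp.ext_iff.mp hrepr i
    have hj := Finsupp.ext_iff.mp hrepr j
    simp only [Finsupp.smul_apply, Finsupp.single_eq_same, Finsupp.single_eq_of_ne hij,
      Finsupp.single_eq_of_ne (Ne.symm hij), smul_eq_mul, mul_one, mul_zero] at hi hj
    rcases hac with ha | hc
    · exact ha hi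
    · exact hc hj.symm
  -- the index type is nonempty since `L ≠ ⊥`
  have hne : Nonempty (Module.Free.ChooseBasisIndex ℤ L) := by
    by_contra hempty
    rw [not_nonempty_iff] at hempty
    apply hL
    rw [Submodule.eq_bot_iff]
    intro x hx
    have : (⟨x, hx⟩ : L) = 0 := b.repr.injective (Subsingleton.elim _ _)
    exact congrArg Subtype.val this
  obtain ⟨i₀⟩ := hne
  have hcard : Fintype.card (Module.Free.ChooseBasisIndex ℤ L) = 1 :=
    Fintype.card_eq_one_iff.mpr ⟨i₀, fun j => hsub j i₀⟩
  rw [Module.finrank_eq_card_basis b, hcard]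

end Lines


end Takahashi2001

/-! ### The named fact from the geometric dictionary, in Brandt coordinates -/

section Glue

open scoped BigOperators
open Literature.NumberTheory.Automorphic Literature.NumberTheory.EllipticCurves.ModularForms

/-- **Theorem 2.3 in Brandt coordinates, for one curve and one setup** (the pointwise form of
`takahashi2001_thm_2_3_of_brandtDictionary` below; Takahashi 2001 §2 with the identification of
p. 84): given, inside the Brandt module `ℤ^{Cls O}` of a setup `S` of type `(M, r)` with Gross's
pairing `Σ_i w_i x_i y_i`, a sublattice `X` (the character group `X_r(J₀(Mr))`), maps
`pb = π^* : ℤ → X`, `pf = π_* : X → ℤ` adjoint for `u_E(a, b) = c_r a b`, `c_r = ord_r Δ_min(W)`,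
with `π_* π^* = P.modularDegree`, `π_*` surjective, and `π^* 1 = j g` for a generator `g ∈ X` of
the `a(W)`-eigen-line of the Brandt matrices, the conclusion of the named fact holds for
`(W, P, S)`: `∃ i j, 0 < i ∧ i j = c_r ∧ i ∣ ξ_S ∧ δ i = ξ_S j`. Proof: `exists_nat_index_formula`
with `h_r = u_J(g, g) = Σ_i w_i g_i² = S.xi` (`xi_lFunction_eq_sum`) and `c_r > 0`
(`r ∣ N_E ∣ Δ_min`). [cite: Takahashi2001, Thm. 2.3 and proof of Thm. 3.8 (p. 84)] -/
theorem Takahashi2001.exists_ij_of_brandtData (W : WeierstrassCurve ℚ) [W.IsElliptic] (M r : ℕ)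
    [NeZero (M * r)] (hr : r.Prime) (hN : W.conductorNorm ℤ = M * r)
    (P : ModularParametrizationData W (M * r)) (S : Brandt.XiSetup M r)
    [Fintype (Brandt.ClassSet S.O)] (X : Submodule ℤ (Brandt.ClassSet S.O → ℤ)) (pb : ℤ →ₗ[ℤ] X)
    (pf : X →ₗ[ℤ] ℤ) (g : X) (j : ℤ)
    (hadj : ∀ (a : ℤ) (y : X),
      ∑ i, (Brandt.weight S.O i : ℤ) * (pb a : Brandt.ClassSet S.O → ℤ) i *
          (y : Brandt.ClassSet S.O → ℤ) i =
        ((W.minimalDiscriminantNorm ℤ).factorization r : ℤ) * a * pf y)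
    (hδ : ∀ a : ℤ, pf (pb a) = (P.modularDegree : ℤ) * a) (hsurj : Function.Surjective pf)
    (hg : pb 1 = j • g)
    (hL : Brandt.eigenLattice (M * r) (Brandt.matrix S.O) (fun n => W.LFunction n) =
      ℤ ∙ (g : Brandt.ClassSet S.O → ℤ)) :
    ∃ i j : ℕ, 0 < i ∧ i * j = (W.minimalDiscriminantNorm ℤ).factorization r ∧
      i ∣ S.xi (fun n => W.LFunction n) ∧
      P.modularDegree * i = S.xi (fun n => W.LFunction n) * j := by
  classical
  set c : ℕ := (W.minimalDiscriminantNorm ℤ).factorization r with hc_def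
  set δ : ℕ := P.modularDegree with hδ_def
  -- `c_r = ord_r Δ_min > 0`: `r ∣ N_E = M r ∣ Δ_min ≠ 0`
  have hc0 : 0 < c := by
    have hfin := WeierstrassCurve.finite_setOf_ordMinimalDiscriminant_ne_zero_holds (A := ℤ) W
    have hdvd : W.conductorNorm ℤ ∣ W.minimalDiscriminantNorm ℤ :=
      W.conductorNorm_dvd_minimalDiscriminantNorm hfin
    have hpos : 0 < W.minimalDiscriminantNorm ℤ := W.minimalDiscriminantNorm_pos_holds
    have hrd : r ∣ W.minimalDiscriminantNorm ℤ :=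
      dvd_trans ⟨M, by rw [hN, mul_comm]⟩ hdvd
    exact hr.factorization_pos_of_dvd hpos.ne' hrd
  -- Gross's pairing on `ℤ^{Cls O}` and its restriction `u_J` to `X`; `u_E(a, b) = c a b` on `ℤ`
  let B : (Brandt.ClassSet S.O → ℤ) →ₗ[ℤ] (Brandt.ClassSet S.O → ℤ) →ₗ[ℤ] ℤ :=
    LinearMap.mk₂ ℤ (fun x y => ∑ i, (Brandt.weight S.O i : ℤ) * x i * y i)
      (fun x₁ x₂ y => by
        simp only [Pi.add_apply, mul_add, add_mul, Finset.sum_add_distrib])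
      (fun a x y => by
        simp only [Pi.smul_apply, smul_eq_mul, Finset.mul_sum]
        exact Finset.sum_congr rfl fun i _ => by ring)
      (fun x y₁ y₂ => by
        simp only [Pi.add_apply, mul_add, Finset.sum_add_distrib])
      (fun a x y => by
        simp only [Pi.smul_apply, smul_eq_mul, Finset.mul_sum]
        exact Finset.sum_congr rfl fun i _ => by ring)
  have hB : ∀ x y : Brandt.ClassSet S.O → ℤ, B x y = ∑ i, (Brandt.weight S.O i : ℤ) * x i * y i :=
    fun x y => rfl
  let uJ : X →ₗ[ℤ] X →ₗ[ℤ] ℤ := B.compl₁₂ X.subtype X.subtype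
  have huJ : ∀ x y : X, uJ x y = ∑ i, (Brandt.weight S.O i : ℤ) * (x : Brandt.ClassSet S.O → ℤ) i *
      (y : Brandt.ClassSet S.O → ℤ) i := fun x y => by
    simp only [uJ, LinearMap.compl₁₂_apply, Submodule.coe_subtype, hB]
  let uE : ℤ →ₗ[ℤ] ℤ →ₗ[ℤ] ℤ :=
    LinearMap.mk₂ ℤ (fun a b => (c : ℤ) * a * b) (fun a₁ a₂ b => by ring)
      (fun m a b => by simp only [smul_eq_mul]; ring) (fun a b₁ b₂ => by ring)
      (fun m a b => by simp only [smul_eq_mul]; ring)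
  have huE : ∀ a b : ℤ, uE a b = (c : ℤ) * a * b := fun a b => rfl
  -- the hypotheses of the abstract theorem
  have hadj' : ∀ (a : ℤ) (y : X), uJ (pb a) y = uE a (pf y) := fun a y => by
    rw [huJ, huE, ← hadj a y]
  have hδ' : ∀ a : ℤ, pf (pb a) = (δ : ℤ) • a := fun a => by rw [hδ a, smul_eq_mul]
  have hgen : ∀ x : ℤ, ∃ m : ℤ, m • (1 : ℤ) = x := fun x => ⟨x, by rw [smul_eq_mul, mul_one]⟩
  have hc' : uE 1 1 = (c : ℤ) := by rw [huE, mul_one, mul_one]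
  -- `g ≠ 0` (as `π_* π^* x_r = δ x_r ≠ 0`), so `S.xi = Σ w_i g_i²` (`xi_lFunction_eq_sum`)
  have hδ0 : 0 < δ := P.deg_pos
  have hg0 : (g : Brandt.ClassSet S.O → ℤ) ≠ 0 := by
    intro h0
    have hg' : g = 0 := by ext i; exact congrFun h0 i
    have h1 := hδ 1
    rw [hg, hg', smul_zero, map_zero, mul_one] at h1
    exact hδ0.ne' (by exact_mod_cast h1.symm)
  have hxi : S.xi (fun n => W.LFunction n) =
      ∑ i, Brandt.weight S.O i * ((g : Brandt.ClassSet S.O → ℤ) i).natAbs ^ 2 :=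
    xi_lFunction_eq_sum W S hg0 hL
  have hh : uJ g g = (S.xi (fun n => W.LFunction n) : ℤ) := by
    rw [hxi, huJ, Nat.cast_sum]
    exact Finset.sum_congr rfl fun i _ => by push_cast; rw [sq_abs]; ring
  exact Takahashi2001.exists_nat_index_formula uJ uE pb pf hadj' hδ' hsurj hgen hc' hc0 hg hh

/-- **`takahashi2001_thm_2_3` from the character-group dictionary** (Takahashi 2001 §2 with the
identification of p. 84). The hypothesis `H` is the geometric input (M1)–(M5) of the module
docstring, written in the coordinates of a Brandt setup `S = (D, O)` of type `(M, r)`: for the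
optimal curve `W` (datum `P` of minimal degree) there are
* a sublattice `X ⊆ ℤ^{Cls O}` — the image of the character group `X_r(J₀(Mr))` under the
  Deligne–Rapoport/Ribet isometry `X_r(J₀(Mr)) ≅ ℤ[Cls O]⁰`, under which Grothendieck's pairing
  `u_J` becomes Gross's `⟨x, y⟩ = Σ_i w_i x_i y_i`, `w_i = #O_L(I_i)ˣ/2` [cite: Ribet1990, §3]
  (Takahashi p. 84 via Buzzard Thm. 4.7);
* `pb = π^* : X_r(E) = ℤ x_r → X` and `pf = π_* : X → ℤ x_r` (coordinate `x_r ↦ 1`), adjoint for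
  `u_J` and `u_E(a x_r, b x_r) = c_r a b` with `c_r = u_E(x_r, x_r) = ord_r Δ_min(E)` (Tate curve;
  Takahashi p. 75 "`c_r = ord_r(Δ)`", p. 79 "`c_r = u_E(x_r, x_r)`"), with `π_* π^* = δ =
  P.modularDegree` (p. 77) and `π_*` surjective (optimality, p. 78);
* `g = g_r ∈ X` generating the `a(E)`-eigen-line of the Brandt matrices (`L_r(J)`, "free of rank
  one", p. 78; Hecke-compatibility of the isometry) with `π^* x_r = j · g` (p. 79).
Given `H`, the fact is `Takahashi2001.exists_nat_index_formula` together with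
`h_r = u_J(g, g) = Σ_i w_i g_i² = S.xi (a(E))` (`xi_lFunction_eq_sum`) and
`c_r = ord_r Δ_min > 0` (`r ∣ N_E ∣ Δ_min`, tree: `conductorNorm_dvd_minimalDiscriminantNorm`).
PROVED; `H` itself (Néron models, SGA7 IX 11.5, Deligne–Rapoport, multiplicity one, analytic =
algebraic degree) is not in the tree. [cite: Takahashi2001, Thm. 2.3 and proof of Thm. 3.8 (p. 84)] -/
theorem takahashi2001_thm_2_3_of_brandtDictionary
    (H : ∀ (W : WeierstrassCurve ℚ) [W.IsElliptic] (M r : ℕ) [NeZero (M * r)],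
      r.Prime → Squarefree (M * r) → W.conductorNorm ℤ = M * r →
      ∀ P : ModularParametrizationData W (M * r),
        (∀ (W' : WeierstrassCurve ℚ) [W'.IsElliptic] (P' : ModularParametrizationData W' (M * r)),
            P'.f = P.f → P.modularDegree ≤ P'.modularDegree) →
        ∀ (S : Brandt.XiSetup M r) [Fintype (Brandt.ClassSet S.O)],
          ∃ (X : Submodule ℤ (Brandt.ClassSet S.O → ℤ)) (pb : ℤ →ₗ[ℤ] X) (pf : X →ₗ[ℤ] ℤ)
            (g : X) (j : ℤ),
            (∀ (a : ℤ) (y : X),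
                ∑ i, (Brandt.weight S.O i : ℤ) * (pb a : Brandt.ClassSet S.O → ℤ) i *
                    (y : Brandt.ClassSet S.O → ℤ) i =
                  ((W.minimalDiscriminantNorm ℤ).factorization r : ℤ) * a * pf y) ∧
            (∀ a : ℤ, pf (pb a) = (P.modularDegree : ℤ) * a) ∧
            Function.Surjective pf ∧
            pb 1 = j • g ∧
            Brandt.eigenLattice (M * r) (Brandt.matrix S.O) (fun n => W.LFunction n) =
              ℤ ∙ (g : Brandt.ClassSet S.O → ℤ)) :
    takahashi2001_thm_2_3 := by
  intro W _ M r _ hr hsq hN P hmin S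
  classical
  letI : Fintype (Brandt.ClassSet S.O) := Fintype.ofFinite _
  obtain ⟨X, pb, pf, g, j, hadj, hδ, hsurj, hg, hL⟩ := H W M r hr hsq hN P hmin S
  exact Takahashi2001.exists_ij_of_brandtData W M r hr hN P S X pb pf g j hadj hδ hsurj hg hL

/-- **Pointwise form with the multiplicity-one input as a rank statement**: as
`Takahashi2001.exists_ij_of_brandtData`, but instead of an explicit generator `g` one assumes that
the `a(W)`-eigen-lattice of the Brandt matrices has rank one ("`L_r(J)` is a free `ℤ`-module of
rank one", Takahashi p. 78 — Jacquet–Langlands and multiplicity one), that `π^* 1` lies in it (p. 78: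
"The image of `π^*` lies in `L_r(J)`"), and that `X` is saturated in `ℤ^{Cls O}` (true for the
degree-zero sublattice `X_r(J₀(Mr)) ≅ ℤ[Cls O]⁰`). The generator is then produced by
`exists_eq_span_of_finrank_eq_one`, and lies in `X` by saturation (`π^* 1 = j g ≠ 0`).
[cite: Takahashi2001, Thm. 2.3 and §2 p. 78] -/
theorem Takahashi2001.exists_ij_of_brandtData' (W : WeierstrassCurve ℚ) [W.IsElliptic] (M r : ℕ)
    [NeZero (M * r)] (hr : r.Prime) (hN : W.conductorNorm ℤ = M * r)
    (P : ModularParametrizationData W (M * r)) (S : Brandt.XiSetup M r)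
    [Fintype (Brandt.ClassSet S.O)] (X : Submodule ℤ (Brandt.ClassSet S.O → ℤ)) (pb : ℤ →ₗ[ℤ] X)
    (pf : X →ₗ[ℤ] ℤ)
    (hadj : ∀ (a : ℤ) (y : X),
      ∑ i, (Brandt.weight S.O i : ℤ) * (pb a : Brandt.ClassSet S.O → ℤ) i *
          (y : Brandt.ClassSet S.O → ℤ) i =
        ((W.minimalDiscriminantNorm ℤ).factorization r : ℤ) * a * pf y)
    (hδ : ∀ a : ℤ, pf (pb a) = (P.modularDegree : ℤ) * a) (hsurj : Function.Surjective pf)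
    (hXsat : ∀ (m : ℤ) (v : Brandt.ClassSet S.O → ℤ), m ≠ 0 → m • v ∈ X → v ∈ X)
    (hrank : Module.finrank ℤ
      (Brandt.eigenLattice (M * r) (Brandt.matrix S.O) (fun n => W.LFunction n)) = 1)
    (hmem : (pb 1 : Brandt.ClassSet S.O → ℤ) ∈
      Brandt.eigenLattice (M * r) (Brandt.matrix S.O) (fun n => W.LFunction n)) :
    ∃ i j : ℕ, 0 < i ∧ i * j = (W.minimalDiscriminantNorm ℤ).factorization r ∧
      i ∣ S.xi (fun n => W.LFunction n) ∧
      P.modularDegree * i = S.xi (fun n => W.LFunction n) * j := by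
  obtain ⟨g₀, hg₀, hL⟩ := Takahashi2001.exists_eq_span_of_finrank_eq_one hrank
  rw [hL] at hmem
  obtain ⟨j, hj⟩ := Submodule.mem_span_singleton.mp hmem
  -- `j ≠ 0` since `π_* π^* 1 = δ ≠ 0`
  have hj0 : j ≠ 0 := by
    rintro rfl
    have h0 : pb 1 = 0 := Subtype.ext (by rw [← hj, zero_smul]; rfl)
    have h1 := hδ 1
    rw [h0, map_zero, mul_one] at h1
    exact P.deg_pos.ne' (by exact_mod_cast h1.symm)
  -- `g₀ ∈ X` by saturation
  have hg₀X : g₀ ∈ X := hXsat j g₀ hj0 (by rw [hj]; exact (pb 1).2)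
  refine Takahashi2001.exists_ij_of_brandtData W M r hr hN P S X pb pf ⟨g₀, hg₀X⟩ j hadj hδ hsurj
    (Subtype.ext ?_) hL
  rw [← hj]
  rfl

/-- **`takahashi2001_thm_2_3` from the character-group dictionary, rank form**: as
`takahashi2001_thm_2_3_of_brandtDictionary`, with the eigen-line hypothesis replaced by
"the `a(W)`-eigen-lattice has rank one and contains `π^* 1`" and saturation of `X` — the shape in
which (M4) Deligne–Rapoport/Ribet (`X = ℤ[Cls O]⁰`, saturated) and (M5) multiplicity one (rank
one) are printed. PROVED (from `Takahashi2001.exists_ij_of_brandtData'`).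
[cite: Takahashi2001, Thm. 2.3 and proof of Thm. 3.8 (p. 84)] -/
theorem takahashi2001_thm_2_3_of_brandtDictionary'
    (H : ∀ (W : WeierstrassCurve ℚ) [W.IsElliptic] (M r : ℕ) [NeZero (M * r)],
      r.Prime → Squarefree (M * r) → W.conductorNorm ℤ = M * r →
      ∀ P : ModularParametrizationData W (M * r),
        (∀ (W' : WeierstrassCurve ℚ) [W'.IsElliptic] (P' : ModularParametrizationData W' (M * r)),
            P'.f = P.f → P.modularDegree ≤ P'.modularDegree) →
        ∀ (S : Brandt.XiSetup M r) [Fintype (Brandt.ClassSet S.O)],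
          ∃ (X : Submodule ℤ (Brandt.ClassSet S.O → ℤ)) (pb : ℤ →ₗ[ℤ] X) (pf : X →ₗ[ℤ] ℤ),
            (∀ (a : ℤ) (y : X),
                ∑ i, (Brandt.weight S.O i : ℤ) * (pb a : Brandt.ClassSet S.O → ℤ) i *
                    (y : Brandt.ClassSet S.O → ℤ) i =
                  ((W.minimalDiscriminantNorm ℤ).factorization r : ℤ) * a * pf y) ∧
            (∀ a : ℤ, pf (pb a) = (P.modularDegree : ℤ) * a) ∧
            Function.Surjective pf ∧
            (∀ (m : ℤ) (v : Brandt.ClassSet S.O → ℤ), m ≠ 0 → m • v ∈ X → v ∈ X) ∧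
            Module.finrank ℤ
                (Brandt.eigenLattice (M * r) (Brandt.matrix S.O) (fun n => W.LFunction n)) = 1 ∧
            (pb 1 : Brandt.ClassSet S.O → ℤ) ∈
              Brandt.eigenLattice (M * r) (Brandt.matrix S.O) (fun n => W.LFunction n)) :
    takahashi2001_thm_2_3 := by
  intro W _ M r _ hr hsq hN P hmin S
  classical
  letI : Fintype (Brandt.ClassSet S.O) := Fintype.ofFinite _
  obtain ⟨X, pb, pf, hadj, hδ, hsurj, hXsat, hrank, hmem⟩ := H W M r hr hsq hN P hmin S
  exact Takahashi2001.exists_ij_of_brandtData' W M r hr hN P S X pb pf hadj hδ hsurj hXsat hrank hmem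

end Glue

end Literature.NumberTheory.EllipticCurves
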